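import Summits.AtomisticToContinuum.BoseEinsteinCondensation.Theorems.BECGroundStateSOSPeriodicIRBoundTwoSectorReduction
import Summits.AtomisticToContinuum.BoseEinsteinCondensation.Theorems.BECGroundStateSOSPeriodicIRBoundOfClassUniform
import Summits.AtomisticToContinuum.BoseEinsteinCondensation.Theorems.BECThomsonPrincipleGDTransferDefs
import HarnessLib

/-!
# Route `BECGroundStateSOS`, crux `PeriodicIRBound` (stmt-AtomisticToContinuum-3972) —
# the difficulty floor of the two round-2 crux lines, as importable theorems

Round 2 of crux ideation produced two checked lines for the crux `PeriodicIRBound` (the `T = 0` infrared bound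
`n_k ≤ C√ρ·L_N/‖k‖` on the Goldstone window for near-minimisers of the periodic `N`-body energy):

* `two-sector-gd-transfer` (lead seats c11, c12): complete modulo its two POOLED inputs — two-sector Gaussian
  domination `BECTwoSectorGD.GaussianDomination` (stmt-AtomisticToContinuum-12620) and midpoint near-convexity
  `BECSectorPoincareTwoScale.EnergyConvexityWindow` (stmt-AtomisticToContinuum-9094) — and the scope half
  `TwoSectorGdTransfer.NonIntegrableHalf` (the crux on `∫ v = ∞`); standing reduction
  `TwoSectorGdTransfer.stub_integrableHalfOfPooled` / `stub_periodicIRBoundOfPooled` (p139109).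
* `hardcore-monotone-class-uniformity` (lead seat a1): complete modulo the class-uniform bounded unit-range half
  `C⁺(1)` (`HardcoreMonotoneClassUniformity.stub_classUniformIR`); its floor `stub_floorOfClassUniformOne` is
  already landed (p136757) and is only re-exported here.

This file records, as kernel-checked compositions of LANDED theorems, the lower bound on what those residual
inputs assert: each residual implies Bose–Einstein condensation of the near-minimisers in the thermodynamic torus
`L_N = (N/ρ)^{1/3}` at every small density (`GDTransfer.DysonDressedWitness.PeriodicBECFor v`, the periodic form of
the summit conjunct) — for every integrable admissible `v` from the two pooled items alone, and for every
admissible `v` once the scope half is added. The composition is the landed per-potential mode counting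
`LandauToPeriodicBEC.periodicBEC_of_irBoundFor` (p99222) after the line's reduction; it is the round-2 twin of
`DifficultyFloor.stub_difficultyFloor` (p132197, round-1 lines). Consequence for planning: no reshape INSIDE either
round-2 line can lower its residual below torus TL-BEC; the residual inputs are the open problems their own routes
say they are (stmt-12620: Gaussian domination without reflection positivity; stmt-9094: convexity of
`N ↦ E₀^per(N, L)` to `o(√(ρa)/L)`; C⁺(1): the bounded half of the crux itself).
-/

noncomputable section

open MeasureTheory Filter
open scoped ENNReal NNReal

namespace Summit.AtomisticToContinuum.BoseEinsteinCondensation.Cruxes.PeriodicIRBound.DifficultyFloorR2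

open Literature.MathematicalPhysics.QuantumManyBody.BoseGas
open Summit.AtomisticToContinuum.BoseEinsteinCondensation.Theses.BECTwoSectorGD (GaussianDomination)
open Summit.AtomisticToContinuum.BoseEinsteinCondensation.Theses.BECSectorPoincareTwoScale (EnergyConvexityWindow)
open Summit.AtomisticToContinuum.BoseEinsteinCondensation.Theorems.PeriodicIRBound.Negative
  (IRBoundFor NearMin InWindow IRIneq)
open Summit.AtomisticToContinuum.BoseEinsteinCondensation.Theorems.LandauToPeriodicBEC (periodicBEC_of_irBoundFor)
open Summit.AtomisticToContinuum.BoseEinsteinCondensation.Cruxes.PeriodicIRBound.TwoSectorGdTransfer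
  (NonIntegrableHalf stub_integrableHalfOfPooled stub_periodicIRBoundOfPooled)
open Summit.AtomisticToContinuum.BoseEinsteinCondensation.Cruxes.PeriodicIRBound.HardcoreMonotoneClassUniformity
  (stub_floorOfClassUniformOne)
-- `PeriodicBECFor v` = torus BEC of the `δ`-near-minimisers at every small density, eventually in `N`
-- (landed vocabulary of the sibling crux `GDTransfer`, reused verbatim as in `DifficultyFloor`, not re-declared)
open Summit.AtomisticToContinuum.BoseEinsteinCondensation.Cruxes.GDTransfer.DysonDressedWitness (PeriodicBECFor)

/-- **Difficulty floor of line `two-sector-gd-transfer`, integrable potentials.** Its two pooled open inputs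
`GaussianDomination` (stmt-12620) and `EnergyConvexityWindow` (stmt-9094) together imply torus BEC in the
thermodynamic box at every small density for EVERY repulsive finite-range integrable pair potential (the line's own
stubs S3, S4, S5 being landed): `stub_integrableHalfOfPooled` (p139109) composed with `periodicBEC_of_irBoundFor`
(p99222). [folklore] -/
theorem periodicBECFor_integrable_of_twoSectorInputs (h1 : GaussianDomination) (h2 : EnergyConvexityWindow) :
    ∀ v : ℝ → ℝ≥0∞, IsRepulsiveFiniteRange v → (∫⁻ x : Space, v ‖x‖) ≠ ⊤ → PeriodicBECFor v :=
  fun v hv hint => periodicBEC_of_irBoundFor v hv (stub_integrableHalfOfPooled h1 h2 v hv hint)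

/-- **Difficulty floor of line `two-sector-gd-transfer`, full residual.** The complete residual stub set of the
line — the two pooled inputs and the scope half `NonIntegrableHalf` — implies torus BEC in the thermodynamic box at
every small density for EVERY repulsive finite-range pair potential, hard cores included:
`stub_periodicIRBoundOfPooled` (p139109) composed with `periodicBEC_of_irBoundFor` (p99222). [folklore] -/
theorem periodicBECFor_of_twoSectorResidual (h1 : GaussianDomination) (h2 : EnergyConvexityWindow)
    (h6 : NonIntegrableHalf) :
    ∀ v : ℝ → ℝ≥0∞, IsRepulsiveFiniteRange v → PeriodicBECFor v :=
  fun v hv => periodicBEC_of_irBoundFor v hv (stub_periodicIRBoundOfPooled h1 h2 h6 v hv)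

/-- **Registered by-product sub-goal `stub_difficultyFloorR2`** of the crux ledger (line lead seat c12): the
round-2 floors in one conjunction — the `two-sector-gd-transfer` residual {stmt-12620, stmt-9094} implies torus
TL-BEC for every admissible integrable pair potential, the same residual with the scope half `NonIntegrableHalf`
implies it for every admissible pair potential, and so does the `hardcore-monotone-class-uniformity` residual C⁺(1)
alone (re-export of the landed `stub_floorOfClassUniformOne`, p136757). [folklore] -/
theorem stub_difficultyFloorR2 :
    (GaussianDomination → EnergyConvexityWindow →
      ∀ v : ℝ → ℝ≥0∞, IsRepulsiveFiniteRange v → (∫⁻ x : Space, v ‖x‖) ≠ ⊤ → PeriodicBECFor v) ∧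
    (GaussianDomination → EnergyConvexityWindow → NonIntegrableHalf →
      ∀ v : ℝ → ℝ≥0∞, IsRepulsiveFiniteRange v → PeriodicBECFor v) ∧
    ((∀ κ : ℝ, 0 < κ → ∃ ρ₀ : ℝ, 0 < ρ₀ ∧ ∃ C : ℝ, 0 < C ∧ ∀ ρ : ℝ, 0 < ρ → ρ < ρ₀ →
      ∀ᶠ N : ℕ in atTop, ∃ δ : ℝ≥0∞, 0 < δ ∧
        ∀ w : ℝ → ℝ≥0∞, IsRepulsiveFiniteRange w → (∀ r, 1 < r → w r = 0) →
          (∃ M : ℝ≥0∞, M ≠ ⊤ ∧ ∀ r, w r ≤ M) →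
          ∀ Ψ : PeriodicTrialState N (sideLength ρ N), NearMin w ρ N δ Ψ →
            ∀ k : Fin 3 → ℤ, InWindow κ ρ N k → IRIneq C ρ N Ψ.ψ k) →
      ∀ v : ℝ → ℝ≥0∞, IsRepulsiveFiniteRange v → PeriodicBECFor v) :=
  ⟨periodicBECFor_integrable_of_twoSectorInputs, periodicBECFor_of_twoSectorResidual,
    fun h1 v hv => stub_floorOfClassUniformOne h1 v hv⟩

end Summit.AtomisticToContinuum.BoseEinsteinCondensation.Cruxes.PeriodicIRBound.DifficultyFloorR2

end
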